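import Mathlib
import HarnessLib
import Literature.Probability.RandomPlanarGeometry.NestingTransform
import Literature.Probability.Percolation.NestingPhaseEstimates
import Literature.Probability.Percolation.NestingWeightMeasurable
import Literature.Probability.Percolation.SiteNestingWeightBound
import Summits.CriticalPhenomena.CardyFormulaZ2.Theorems.CardyMagicRigidityMagicFormulaTStubUVSandwich
import Summits.CriticalPhenomena.CardyFormulaZ2.Theorems.CardyMagicRigidityMagicFormulaTCountRepresentation
import Summits.CriticalPhenomena.CardyFormulaZ2.Theorems.CardyMagicRigidityMagicFormulaTCountRepresentation3

/-!
# Line `Sketch` for crux `MagicFormulaT`, sub-goal `cr4b_expect_powerSums_eq_counts`: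
# the count representation of the four-point power-sum statistics `A₁² A₂`, `A₁⁴` at fixed mesh

Crux `Summit.CriticalPhenomena.CardyFormulaZ2.Theses.CardyMagicRigidity.MagicFormulaT`
(stmt-CriticalPhenomena-4836), line `Sketch`, registered sub-goal
`cr4b_expect_powerSums_eq_counts`: part (b) of the order-4 analogue of the landed order-2 and
order-3 bridges `cr_expect_powerSums_eq_counts`, `cr3_expect_powerSums_eq_counts`.  With
`θ_u = u.nestingPhase f = ∫_{W(u,·) ≠ 0} f` over the interface loops `u` of `siteLoopConfig δ ω`
under `triSitePercolation half`, an admissible density `f` (measurable, `|f| ≤ C`, `f = 0` off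
`B̄(0, R)`, `∫ f = 0`) and a mesh `δ > 0`:
`E[(Σ_u θ_u)² (Σ_u θ_u²)] = ∫⁴ f f f f E[N(x) N(y) N(z ∧ w)]` and
`E[(Σ_u θ_u)⁴] = ∫⁴ f f f f E[N(x) N(y) N(z) N(w)]`, where
`N(x) = #{u : W(u, x) ≠ 0, u meets B̄(0, R)}` and `N(z ∧ w)` is its two-point analogue.

* §1 the PATHWISE identities (`cr4b_pathwise`): both statistics are products of two of the
  order-2 statistics, so the order-2 identities `cr_pathwise` and "a product of two double
  integrals is a quadruple iterated integral" give them;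
* §2 Fubini (`cr4b_integral_swap`): the order-3 lemma `cr3_integral_swap` applied to the
  partially integrated kernel `∫ f(w) K(·, x, y, z, w) dw`, then `integral_integral_swap`;
* §3 the registered sub-goal: the counts are bounded by the deterministic number of loops meeting
  the ball (`ncard_loops_siteLoopConfig_meeting_le`) and jointly measurable
  (`cr_measurable_ncard_loops`).

Everything is proved from tree / Mathlib material; no named fact is used; no definition is
introduced.
-/

noncomputable section

namespace Summit.CriticalPhenomena.CardyFormulaZ2.Cruxes.MagicFormulaT.LineSketch

open MeasureTheory Filter Set Metric
open scoped Real Topology BigOperators ENNReal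
open Literature.Probability.RandomPlanarGeometry Literature.Probability.Percolation
  Literature.Probability.LatticeModels

/-! ## §1 The pathwise four-point count representation (products of order-2 statistics) -/

/-- **Pathwise four-point count representation, part (b).**  For an admissible density `f` and a
loop family `L` with finitely many loops meeting `B̄(0, R)`, with
`N(x) = #{u ∈ L : W(u,x) ≠ 0, u meets B̄(0,R)}` and its two-point analogue `N(z ∧ w)`:
`(Σ_u θ_u)² (Σ_u θ_u²) = ∫⁴ f f f f N(x) N(y) N(z ∧ w)` and
`(Σ_u θ_u)⁴ = ∫⁴ f f f f N(x) N(y) N(z) N(w)` — the order-2 identities `cr_pathwise` for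
`(Σ_u θ_u)²` and `Σ_u θ_u²`, and products of iterated integrals as iterated integrals. -/
theorem cr4b_pathwise {f : ℂ → ℝ} {R C : ℝ} (hf : Measurable f) (hC : ∀ z, |f z| ≤ C)
    (hR : ∀ z, R < ‖z‖ → f z = 0) (h0 : ∫ z, f z = 0) {L : Set (UnbasedLoop ℂ)}
    (hT : {u ∈ L | (u.range ∩ closedBall (0 : ℂ) R).Nonempty}.Finite) :
    (∑ᶠ u ∈ L, u.nestingPhase f) ^ 2 * (∑ᶠ u ∈ L, u.nestingPhase f ^ 2) =
      ∫ x, ∫ y, ∫ z, ∫ w, f x * f y * f z * f w *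
        ((Set.ncard {u ∈ L | u.wind x ≠ 0 ∧ (u.range ∩ closedBall (0 : ℂ) R).Nonempty} : ℝ) *
          (Set.ncard {u ∈ L | u.wind y ≠ 0 ∧ (u.range ∩ closedBall (0 : ℂ) R).Nonempty} : ℝ) *
          (Set.ncard {u ∈ L | u.wind z ≠ 0 ∧ u.wind w ≠ 0 ∧
            (u.range ∩ closedBall (0 : ℂ) R).Nonempty} : ℝ)) ∧
    (∑ᶠ u ∈ L, u.nestingPhase f) ^ 4 = ∫ x, ∫ y, ∫ z, ∫ w, f x * f y * f z * f w *
        ((Set.ncard {u ∈ L | u.wind x ≠ 0 ∧ (u.range ∩ closedBall (0 : ℂ) R).Nonempty} : ℝ) *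
          (Set.ncard {u ∈ L | u.wind y ≠ 0 ∧ (u.range ∩ closedBall (0 : ℂ) R).Nonempty} : ℝ) *
          (Set.ncard {u ∈ L | u.wind z ≠ 0 ∧ (u.range ∩ closedBall (0 : ℂ) R).Nonempty} : ℝ) *
          (Set.ncard {u ∈ L | u.wind w ≠ 0 ∧
            (u.range ∩ closedBall (0 : ℂ) R).Nonempty} : ℝ)) := by
  obtain ⟨h2, h11⟩ := cr_pathwise hf hC hR h0 hT
  have h4 : ∀ a : ℝ, a ^ 4 = a ^ 2 * a ^ 2 := fun a ↦ by ring
  refine ⟨?_, ?_⟩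
  · -- `(Σ_u θ_u)² (Σ_u θ_u²)`
    rw [h11, h2, ← integral_mul_const]
    refine integral_congr_ae ?_
    filter_upwards with x
    rw [← integral_mul_const]
    refine integral_congr_ae ?_
    filter_upwards with y
    rw [← integral_const_mul]
    refine integral_congr_ae ?_
    filter_upwards with z
    rw [← integral_const_mul]
    refine integral_congr_ae ?_
    filter_upwards with w
    ring
  · -- `(Σ_u θ_u)⁴`
    rw [h4, h11, ← integral_mul_const]
    refine integral_congr_ae ?_
    filter_upwards with x
    rw [← integral_mul_const]
    refine integral_congr_ae ?_
    filter_upwards with y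
    rw [← integral_const_mul]
    refine integral_congr_ae ?_
    filter_upwards with z
    rw [← integral_const_mul]
    refine integral_congr_ae ?_
    filter_upwards with w
    ring

/-! ## §2 Fubini: the expectation past the four spatial integrals -/

/-- **Fubini for a bounded, jointly measurable four-point loop kernel.**  For a finite measure
`P`, an integrable measurable `f` and a jointly measurable kernel `K ω x y z w` with `|K| ≤ B`:
`E[∫⁴ f(x) f(y) f(z) f(w) K(·, x, y, z, w)] = ∫⁴ f(x) f(y) f(z) f(w) E[K(·, x, y, z, w)]` (the
order-3 lemma `cr3_integral_swap` for the partially integrated kernel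
`∫ f(w) K(·, x, y, z, w) dw`, then `MeasureTheory.integral_integral_swap`, domination by
`B |f(w)|`). -/
theorem cr4b_integral_swap {Ω : Type*} [MeasurableSpace Ω] (P : Measure Ω)
    [IsFiniteMeasure P] {f : ℂ → ℝ} (hfi : Integrable f volume) (hfm : Measurable f)
    {K : Ω → ℂ → ℂ → ℂ → ℂ → ℝ} {B : ℝ} (hKB : ∀ ω x y z w, |K ω x y z w| ≤ B)
    (hKm : Measurable fun r : (((Ω × ℂ) × ℂ) × ℂ) × ℂ ↦ K r.1.1.1.1 r.1.1.1.2 r.1.1.2 r.1.2 r.2) :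
    ∫ ω, (∫ x, ∫ y, ∫ z, ∫ w, f x * f y * f z * f w * K ω x y z w) ∂P =
      ∫ x, ∫ y, ∫ z, ∫ w, f x * f y * f z * f w * ∫ ω, K ω x y z w ∂P := by
  have hGm : Measurable fun s : (((Ω × ℂ) × ℂ) × ℂ) × ℂ ↦
      f s.2 * K s.1.1.1.1 s.1.1.1.2 s.1.1.2 s.1.2 s.2 :=
    (hfm.comp measurable_snd).mul hKm
  have hpt : ∀ ω x y z w, ‖f w * K ω x y z w‖ ≤ B * |f w| := fun ω x y z w ↦ by
    rw [Real.norm_eq_abs, abs_mul]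
    exact (mul_le_mul_of_nonneg_left (hKB ω x y z w) (abs_nonneg _)).trans_eq (mul_comm _ _)
  -- the partially integrated kernel `K₃ ω x y z = ∫ f(w) K ω x y z w dw` is bounded ...
  have hK₃B : ∀ ω x y z, |∫ w, f w * K ω x y z w| ≤ B * ∫ w, |f w| := fun ω x y z ↦ by
    rw [← Real.norm_eq_abs, ← integral_const_mul]
    exact norm_integral_le_of_norm_le (hfi.abs.const_mul B)
      (Eventually.of_forall fun w ↦ hpt ω x y z w)
  -- ... and jointly measurable
  have hK₃sm : StronglyMeasurable fun r : ((Ω × ℂ) × ℂ) × ℂ ↦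
      ∫ w, f w * K r.1.1.1 r.1.1.2 r.1.2 r.2 w :=
    hGm.stronglyMeasurable.integral_prod_right'
  -- integrability on `Ω × ℂ` of `(ω, w) ↦ f w K ω x y z w` for every `x, y, z`
  have hI : ∀ x y z, Integrable (Function.uncurry fun ω w ↦ f w * K ω x y z w)
      (P.prod volume) := by
    intro x y z
    have hm : Measurable fun q : Ω × ℂ ↦ f q.2 * K q.1 x y z q.2 :=
      hGm.comp ((((measurable_fst.prodMk measurable_const).prodMk measurable_const).prodMk
        measurable_const).prodMk measurable_snd)
    exact Integrable.mono' ((integrable_const B).mul_prod hfi.abs) hm.aestronglyMeasurable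
      (Eventually.of_forall fun q ↦ hpt q.1 x y z q.2)
  calc ∫ ω, (∫ x, ∫ y, ∫ z, ∫ w, f x * f y * f z * f w * K ω x y z w) ∂P
      = ∫ ω, (∫ x, ∫ y, ∫ z, f x * f y * f z * ∫ w, f w * K ω x y z w) ∂P :=
        integral_congr_ae (Eventually.of_forall fun ω ↦ integral_congr_ae
          (Eventually.of_forall fun x ↦ integral_congr_ae (Eventually.of_forall fun y ↦
            integral_congr_ae (Eventually.of_forall fun z ↦
              (integral_congr_ae (Eventually.of_forall fun w ↦ mul_assoc _ _ _)).trans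
                (integral_const_mul _ _)))))
    _ = ∫ x, ∫ y, ∫ z, f x * f y * f z * ∫ ω, (∫ w, f w * K ω x y z w) ∂P :=
        cr3_integral_swap P hfi hfm hK₃B hK₃sm.measurable
    _ = _ := by
        refine integral_congr_ae ?_
        filter_upwards with x
        refine integral_congr_ae ?_
        filter_upwards with y
        refine integral_congr_ae ?_
        filter_upwards with z
        rw [integral_integral_swap (hI x y z), ← integral_const_mul]
        refine integral_congr_ae ?_
        filter_upwards with w
        rw [integral_const_mul]
        ring

/-! ## §3 The registered sub-goal -/

/-- **Sub-goal `cr4b_expect_powerSums_eq_counts` · count representation of the four-point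
power-sum statistics `A₁² A₂` and `A₁⁴` at fixed mesh.**  For an admissible density `f`
(measurable, `|f| ≤ C`, `f = 0` off `B̄(0, R)`, `∫ f = 0`) and a mesh `δ > 0`, with
`θ_u = ∫_{W(u,·) ≠ 0} f` over the interface loops of `siteLoopConfig δ ω` under
`triSitePercolation half`, `N(x) = #{u : W(u,x) ≠ 0, u meets B̄(0,R)}` and
`N(z ∧ w) = #{u : W(u,z) ≠ 0, W(u,w) ≠ 0, u meets B̄(0,R)}`:
`E[(Σ_u θ_u)² (Σ_u θ_u²)] = ∫⁴ f f f f E[N(x) N(y) N(z ∧ w)]` and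
`E[(Σ_u θ_u)⁴] = ∫⁴ f f f f E[N(x) N(y) N(z) N(w)]`.  Pathwise (`cr4b_pathwise`) only the
finitely many loops meeting `B̄(0, R)` contribute (`ncard_loops_siteLoopConfig_meeting_le`); then
Fubini (`cr4b_integral_swap`): the counts are bounded by the deterministic number of loops
meeting the ball and jointly measurable (`cr_measurable_ncard_loops`). -/
theorem cr4b_expect_powerSums_eq_counts : ∀ (f : ℂ → ℝ) (R C : ℝ), Measurable f → (∀ z, |f z| ≤ C) →
    (∀ z, R < ‖z‖ → f z = 0) → ∫ z, f z = 0 → ∀ δ : ℝ, 0 < δ →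
    (∫ ω, (∑ᶠ u ∈ (siteLoopConfig δ ω).loops, u.nestingPhase f) ^ 2 *
        (∑ᶠ u ∈ (siteLoopConfig δ ω).loops, u.nestingPhase f ^ 2) ∂(triSitePercolation half) =
      ∫ x, ∫ y, ∫ z, ∫ w, f x * f y * f z * f w * ∫ ω, ((Set.ncard {u ∈ (siteLoopConfig δ ω).loops | u.wind x ≠ 0 ∧
        (u.range ∩ Metric.closedBall (0 : ℂ) R).Nonempty} : ℝ) *
        (Set.ncard {u ∈ (siteLoopConfig δ ω).loops | u.wind y ≠ 0 ∧
        (u.range ∩ Metric.closedBall (0 : ℂ) R).Nonempty} : ℝ) *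
        (Set.ncard {u ∈ (siteLoopConfig δ ω).loops | u.wind z ≠ 0 ∧ u.wind w ≠ 0 ∧
        (u.range ∩ Metric.closedBall (0 : ℂ) R).Nonempty} : ℝ)) ∂(triSitePercolation half)) ∧
    (∫ ω, (∑ᶠ u ∈ (siteLoopConfig δ ω).loops, u.nestingPhase f) ^ 4 ∂(triSitePercolation half) =
      ∫ x, ∫ y, ∫ z, ∫ w, f x * f y * f z * f w * ∫ ω, ((Set.ncard {u ∈ (siteLoopConfig δ ω).loops | u.wind x ≠ 0 ∧
        (u.range ∩ Metric.closedBall (0 : ℂ) R).Nonempty} : ℝ) *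
        (Set.ncard {u ∈ (siteLoopConfig δ ω).loops | u.wind y ≠ 0 ∧
        (u.range ∩ Metric.closedBall (0 : ℂ) R).Nonempty} : ℝ) *
        (Set.ncard {u ∈ (siteLoopConfig δ ω).loops | u.wind z ≠ 0 ∧
        (u.range ∩ Metric.closedBall (0 : ℂ) R).Nonempty} : ℝ) *
        (Set.ncard {u ∈ (siteLoopConfig δ ω).loops | u.wind w ≠ 0 ∧
        (u.range ∩ Metric.closedBall (0 : ℂ) R).Nonempty} : ℝ)) ∂(triSitePercolation half)) := by
  intro f R C hf hC hR h0 δ hδ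
  have hfi : Integrable f volume := integrable_of_abs_le_of_eq_zero hf hC hR
  -- finiteness and the deterministic bound on the loops meeting the ball
  have hT : ∀ ω : SiteConfig (Site 2),
      {u ∈ (siteLoopConfig δ ω).loops | (u.range ∩ closedBall (0 : ℂ) R).Nonempty}.Finite :=
    fun ω ↦ (ncard_loops_siteLoopConfig_meeting_le hδ R ω).1
  obtain ⟨Nmax, hNmax⟩ : ∃ N : ℕ, ∀ ω : SiteConfig (Site 2),
      {u ∈ (siteLoopConfig δ ω).loops | (u.range ∩ closedBall (0 : ℂ) R).Nonempty}.ncard ≤ N :=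
    ⟨_, fun ω ↦ (ncard_loops_siteLoopConfig_meeting_le hδ R ω).2⟩
  have h0N : (0 : ℝ) ≤ Nmax := Nat.cast_nonneg _
  have hN₁le : ∀ (ω : SiteConfig (Site 2)) (x : ℂ),
      ((Set.ncard {u ∈ (siteLoopConfig δ ω).loops | u.wind x ≠ 0 ∧
        (u.range ∩ closedBall (0 : ℂ) R).Nonempty} : ℝ)) ≤ Nmax := fun ω x ↦ by
    rw [Nat.cast_le]
    refine (Set.ncard_le_ncard (fun u hu ↦ ?_) (hT ω)).trans (hNmax ω)
    exact ⟨hu.1, hu.2.2⟩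
  have hN₂le : ∀ (ω : SiteConfig (Site 2)) (z w : ℂ),
      ((Set.ncard {u ∈ (siteLoopConfig δ ω).loops | u.wind z ≠ 0 ∧ u.wind w ≠ 0 ∧
        (u.range ∩ closedBall (0 : ℂ) R).Nonempty} : ℝ)) ≤ Nmax := fun ω z w ↦ by
    rw [Nat.cast_le]
    refine (Set.ncard_le_ncard (fun u hu ↦ ?_) (hT ω)).trans (hNmax ω)
    exact ⟨hu.1, hu.2.2.2⟩
  have hN₁₁₂le : ∀ (ω : SiteConfig (Site 2)) (x y z w : ℂ),
      |((Set.ncard {u ∈ (siteLoopConfig δ ω).loops | u.wind x ≠ 0 ∧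
        (u.range ∩ closedBall (0 : ℂ) R).Nonempty} : ℝ)) *
        ((Set.ncard {u ∈ (siteLoopConfig δ ω).loops | u.wind y ≠ 0 ∧
        (u.range ∩ closedBall (0 : ℂ) R).Nonempty} : ℝ)) *
        ((Set.ncard {u ∈ (siteLoopConfig δ ω).loops | u.wind z ≠ 0 ∧ u.wind w ≠ 0 ∧
        (u.range ∩ closedBall (0 : ℂ) R).Nonempty} : ℝ))| ≤ Nmax * Nmax * Nmax :=
    fun ω x y z w ↦ by
    rw [abs_mul, abs_mul, Nat.abs_cast, Nat.abs_cast, Nat.abs_cast]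
    exact mul_le_mul (mul_le_mul (hN₁le ω x) (hN₁le ω y) (Nat.cast_nonneg _) h0N) (hN₂le ω z w)
      (Nat.cast_nonneg _) (mul_nonneg h0N h0N)
  have hN₁₁₁₁le : ∀ (ω : SiteConfig (Site 2)) (x y z w : ℂ),
      |((Set.ncard {u ∈ (siteLoopConfig δ ω).loops | u.wind x ≠ 0 ∧
        (u.range ∩ closedBall (0 : ℂ) R).Nonempty} : ℝ)) *
        ((Set.ncard {u ∈ (siteLoopConfig δ ω).loops | u.wind y ≠ 0 ∧
        (u.range ∩ closedBall (0 : ℂ) R).Nonempty} : ℝ)) *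
        ((Set.ncard {u ∈ (siteLoopConfig δ ω).loops | u.wind z ≠ 0 ∧
        (u.range ∩ closedBall (0 : ℂ) R).Nonempty} : ℝ)) *
        ((Set.ncard {u ∈ (siteLoopConfig δ ω).loops | u.wind w ≠ 0 ∧
        (u.range ∩ closedBall (0 : ℂ) R).Nonempty} : ℝ))| ≤ Nmax * Nmax * Nmax * Nmax :=
    fun ω x y z w ↦ by
    rw [abs_mul, abs_mul, abs_mul, Nat.abs_cast, Nat.abs_cast, Nat.abs_cast, Nat.abs_cast]
    exact mul_le_mul (mul_le_mul (mul_le_mul (hN₁le ω x) (hN₁le ω y) (Nat.cast_nonneg _) h0N)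
      (hN₁le ω z) (Nat.cast_nonneg _) (mul_nonneg h0N h0N)) (hN₁le ω w) (Nat.cast_nonneg _)
      (mul_nonneg (mul_nonneg h0N h0N) h0N)
  -- joint measurability of the counts
  have hwm : ∀ u : UnbasedLoop ℂ, Measurable fun z ↦ u.wind z ≠ 0 := fun u ↦
    measurableSet_setOf.1 (measurableSet_setOf_wind_ne_zero u)
  have hcast : Measurable fun n : ℕ ↦ (n : ℝ) := measurable_from_nat
  have hmX : Measurable fun r : (((SiteConfig (Site 2) × ℂ) × ℂ) × ℂ) × ℂ ↦
      ((Set.ncard {u ∈ (siteLoopConfig δ r.1.1.1.1).loops | u.wind r.1.1.1.2 ≠ 0 ∧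
        (u.range ∩ closedBall (0 : ℂ) R).Nonempty} : ℝ)) :=
    hcast.comp (cr_measurable_ncard_loops hδ R measurable_fst.fst.fst.fst
      (Q := fun r u ↦ u.wind r.1.1.1.2 ≠ 0 ∧ (u.range ∩ closedBall (0 : ℂ) R).Nonempty)
      (fun u ↦ ((hwm u).comp measurable_fst.fst.fst.snd).and measurable_const)
      fun _ _ hu ↦ hu.2)
  have hmY : Measurable fun r : (((SiteConfig (Site 2) × ℂ) × ℂ) × ℂ) × ℂ ↦
      ((Set.ncard {u ∈ (siteLoopConfig δ r.1.1.1.1).loops | u.wind r.1.1.2 ≠ 0 ∧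
        (u.range ∩ closedBall (0 : ℂ) R).Nonempty} : ℝ)) :=
    hcast.comp (cr_measurable_ncard_loops hδ R measurable_fst.fst.fst.fst
      (Q := fun r u ↦ u.wind r.1.1.2 ≠ 0 ∧ (u.range ∩ closedBall (0 : ℂ) R).Nonempty)
      (fun u ↦ ((hwm u).comp measurable_fst.fst.snd).and measurable_const)
      fun _ _ hu ↦ hu.2)
  have hmZ : Measurable fun r : (((SiteConfig (Site 2) × ℂ) × ℂ) × ℂ) × ℂ ↦
      ((Set.ncard {u ∈ (siteLoopConfig δ r.1.1.1.1).loops | u.wind r.1.2 ≠ 0 ∧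
        (u.range ∩ closedBall (0 : ℂ) R).Nonempty} : ℝ)) :=
    hcast.comp (cr_measurable_ncard_loops hδ R measurable_fst.fst.fst.fst
      (Q := fun r u ↦ u.wind r.1.2 ≠ 0 ∧ (u.range ∩ closedBall (0 : ℂ) R).Nonempty)
      (fun u ↦ ((hwm u).comp measurable_fst.snd).and measurable_const)
      fun _ _ hu ↦ hu.2)
  have hmW : Measurable fun r : (((SiteConfig (Site 2) × ℂ) × ℂ) × ℂ) × ℂ ↦
      ((Set.ncard {u ∈ (siteLoopConfig δ r.1.1.1.1).loops | u.wind r.2 ≠ 0 ∧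
        (u.range ∩ closedBall (0 : ℂ) R).Nonempty} : ℝ)) :=
    hcast.comp (cr_measurable_ncard_loops hδ R measurable_fst.fst.fst.fst
      (Q := fun r u ↦ u.wind r.2 ≠ 0 ∧ (u.range ∩ closedBall (0 : ℂ) R).Nonempty)
      (fun u ↦ ((hwm u).comp measurable_snd).and measurable_const)
      fun _ _ hu ↦ hu.2)
  have hmZW : Measurable fun r : (((SiteConfig (Site 2) × ℂ) × ℂ) × ℂ) × ℂ ↦
      ((Set.ncard {u ∈ (siteLoopConfig δ r.1.1.1.1).loops | u.wind r.1.2 ≠ 0 ∧ u.wind r.2 ≠ 0 ∧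
        (u.range ∩ closedBall (0 : ℂ) R).Nonempty} : ℝ)) :=
    hcast.comp (cr_measurable_ncard_loops hδ R measurable_fst.fst.fst.fst
      (Q := fun r u ↦ u.wind r.1.2 ≠ 0 ∧ u.wind r.2 ≠ 0 ∧
        (u.range ∩ closedBall (0 : ℂ) R).Nonempty)
      (fun u ↦ ((hwm u).comp measurable_fst.snd).and (((hwm u).comp measurable_snd).and
        measurable_const))
      fun _ _ hu ↦ hu.2.2)
  refine ⟨?_, ?_⟩
  · calc ∫ ω, (∑ᶠ u ∈ (siteLoopConfig δ ω).loops, u.nestingPhase f) ^ 2 *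
          (∑ᶠ u ∈ (siteLoopConfig δ ω).loops, u.nestingPhase f ^ 2) ∂(triSitePercolation half)
        = ∫ ω, (∫ x, ∫ y, ∫ z, ∫ w, f x * f y * f z * f w *
            ((Set.ncard {u ∈ (siteLoopConfig δ ω).loops | u.wind x ≠ 0 ∧
              (u.range ∩ closedBall (0 : ℂ) R).Nonempty} : ℝ) *
            (Set.ncard {u ∈ (siteLoopConfig δ ω).loops | u.wind y ≠ 0 ∧
              (u.range ∩ closedBall (0 : ℂ) R).Nonempty} : ℝ) *
            (Set.ncard {u ∈ (siteLoopConfig δ ω).loops | u.wind z ≠ 0 ∧ u.wind w ≠ 0 ∧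
              (u.range ∩ closedBall (0 : ℂ) R).Nonempty} : ℝ))) ∂(triSitePercolation half) :=
          integral_congr_ae (Eventually.of_forall fun ω ↦ (cr4b_pathwise hf hC hR h0 (hT ω)).1)
      _ = _ := cr4b_integral_swap (triSitePercolation half) hfi hf hN₁₁₂le
          ((hmX.mul hmY).mul hmZW)
  · calc ∫ ω, (∑ᶠ u ∈ (siteLoopConfig δ ω).loops, u.nestingPhase f) ^ 4
          ∂(triSitePercolation half)
        = ∫ ω, (∫ x, ∫ y, ∫ z, ∫ w, f x * f y * f z * f w *
            ((Set.ncard {u ∈ (siteLoopConfig δ ω).loops | u.wind x ≠ 0 ∧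
              (u.range ∩ closedBall (0 : ℂ) R).Nonempty} : ℝ) *
            (Set.ncard {u ∈ (siteLoopConfig δ ω).loops | u.wind y ≠ 0 ∧
              (u.range ∩ closedBall (0 : ℂ) R).Nonempty} : ℝ) *
            (Set.ncard {u ∈ (siteLoopConfig δ ω).loops | u.wind z ≠ 0 ∧
              (u.range ∩ closedBall (0 : ℂ) R).Nonempty} : ℝ) *
            (Set.ncard {u ∈ (siteLoopConfig δ ω).loops | u.wind w ≠ 0 ∧
              (u.range ∩ closedBall (0 : ℂ) R).Nonempty} : ℝ))) ∂(triSitePercolation half) :=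
          integral_congr_ae (Eventually.of_forall fun ω ↦ (cr4b_pathwise hf hC hR h0 (hT ω)).2)
      _ = _ := cr4b_integral_swap (triSitePercolation half) hfi hf hN₁₁₁₁le
          (((hmX.mul hmY).mul hmZ).mul hmW)

end Summit.CriticalPhenomena.CardyFormulaZ2.Cruxes.MagicFormulaT.LineSketch

end
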